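import Mathlib.Analysis.SpecialFunctions.Exp
import Mathlib.Algebra.BigOperators.Ring.Finset
import HarnessLib

/-!
# Differential privacy as hypothesis testing (finite output space): the Kairouz–Oh–Viswanath
# region inequalities and the membership-inference bounds they imply

Topic `Literature/Probability/HypothesisTesting`.  Sources: P. Kairouz, S. Oh, P. Viswanath,
*The Composition Theorem for Differential Privacy*, IEEE Trans. Inf. Theory **63** (2017) 4037–4049
= arXiv:1311.0776, Definition 1.1 and §2 **Theorem 2.1** [KairouzOhViswanath2017]; S. Yeom,
I. Giacomelli, M. Fredrikson, S. Jha, *Privacy Risk in Machine Learning*, IEEE CSF 2018, §3.1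
Definition 4 / eq. (2) and **Theorem 1** (membership advantage `≤ e^ε − 1` under `ε`-DP) [YeomEtAl2018];
T. Humphries, S. Oya, L. Tulloch, M. Rafuse, I. Goldberg, U. Hengartner, F. Kerschbaum,
*Investigating Membership Inference Attacks under Data Dependencies*, arXiv:2010.12112 (IEEE CSF
2023), §III **Theorem III.1** eq. (2) (membership advantage `≤ (e^ε − 1 + 2δ)/(e^ε + 1)` under
`(ε, δ)`-DP, proved there exactly by adding the two Kairouz–Oh–Viswanath conditions)
[HumphriesEtAl2020MembershipInferenceDependencies].

HONEST FRAMING (pub-qadeq lane context, CLAIMS row A-325 / DEQ-A325: a paper compares an empirical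
membership-inference ‘attack success rate’ with a ‘theoretical bound’ `(e^ε + δ)/(1 + e^ε)` for an
`(ε, δ)`-differentially-private pipeline): instance-level adjudication of specific advantage
claims; no claim about BQP vs BPP or the summit.  This file proves the two-line inequality behind
that bound from the printed definition of `(ε, δ)`-DP, for ONE pair of neighbouring output laws on
a finite output space and DETERMINISTIC rejection regions (exactly the objects of the cited
Theorem 2.1).  It says nothing about any mechanism, dataset or experiment.

## Contents (all proved, 0 named facts)

* `regionMass p S = Σ_{x ∈ S} p x` — the probability a law `p : X → ℝ` on the finite output space
  gives to the rejection region `S`.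
* `RegionwiseLE ε δ p q` — the one-sided `(ε, δ)` inequality of Definition 1.1 for the pair of
  output laws `p = law M(D)`, `q = law M(D')`: `P(S) ≤ e^ε Q(S) + δ` for every region `S`
  [cite: KairouzOhViswanath2017, Def. 1.1]; `IsDPPair ε δ p q` — both directions (neighbourhood
  is symmetric, so `(ε, δ)`-DP of `M` gives both for every neighbouring pair).
* `pfa_add_exp_mul_pmd_ge`, `exp_mul_pfa_add_pmd_ge` — **Theorem 2.1, direction ‘DP ⇒ conditions’**
  for the pair: with the null hypothesis `H₀ : p₀` and the alternative `H₁ : p₁`, false-alarm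
  probability `P_FA(S) = p₀(S)` and missed-detection probability `P_MD(S) = 1 − p₁(S)`,
  `P_FA + e^ε P_MD ≥ 1 − δ` and `e^ε P_FA + P_MD ≥ 1 − δ` for every rejection region `S`
  [cite: KairouzOhViswanath2017, §2 Thm 2.1 eq. (1)];
  `isDPPair_iff_regionConditions` — the full **‘if and only if’** of Theorem 2.1 for the pair.
* Consequences for a membership test that answers ‘member’ on the region `S`
  (true-positive rate `TPR = p₁(S)`, false-positive rate `FPR = p₀(S)`):
  `tpr_sub_fpr_le` — `TPR − FPR ≤ (e^ε − 1 + 2δ)/(e^ε + 1)`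
  [cite: HumphriesEtAl2020MembershipInferenceDependencies, Thm III.1 eq. (2)];
  `balancedAccuracy_le` — `(TPR + (1 − FPR))/2 ≤ (e^ε + δ)/(e^ε + 1)` (the ‘theoretical bound on
  attack success’ quoted in the lane's A-325 record: `62.2 %` at `(ε, δ) = (0.5, 0)`, `73.1 %` at
  `(1, 10⁻⁵)`); `tpr_sub_fpr_le_exp_sub_one` — hence `TPR − FPR ≤ e^ε − 1` for `δ = 0`, the
  form of [cite: YeomEtAl2018, §3.1 Thm 1] (there stated for an `ε`-DP learning algorithm in the
  membership experiment of its Def. 4 / eq. (2); here for two output laws).  All three are the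
  two-line consequences of Theorem 2.1 printed in the cited sources; the plumbing lemmas
  (`regionMass_compl…`) are private.

Not covered: mechanisms as maps from databases (the statements here are per neighbouring pair,
which is what Definition 1.1 quantifies over), randomised tests, infinite output spaces, the
composition theorem itself (KOV Thm 3.3) and any Gaussian / Rényi accountant.
-/

noncomputable section

namespace Literature.Probability.HypothesisTesting

open Finset Real

variable {X : Type*} [Fintype X] [DecidableEq X]

/-! ## Region masses and the `(ε, δ)` inequalities of Definition 1.1 -/

/-- The mass `P(S) = Σ_{x ∈ S} p(x)` a law `p` on the finite output space gives to the rejection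
region `S`. [folklore] -/
def regionMass (p : X → ℝ) (S : Finset X) : ℝ := ∑ x ∈ S, p x

omit [DecidableEq X] in
/-- The whole space has mass `Σ_x p x`. [folklore] -/
private theorem regionMass_univ (p : X → ℝ) : regionMass p univ = ∑ x, p x := rfl

/-- Complement rule: `P(Sᶜ) = P(univ) − P(S)`. [folklore] -/
private theorem regionMass_compl (p : X → ℝ) (S : Finset X) :
    regionMass p Sᶜ = regionMass p univ - regionMass p S := by
  unfold regionMass
  rw [eq_sub_iff_add_eq, Finset.sum_compl_add_sum]

/-- For a law of total mass one, `P(Sᶜ) = 1 − P(S)`. [folklore] -/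
private theorem regionMass_compl_of_sum_eq_one {p : X → ℝ} (hp : ∑ x, p x = 1) (S : Finset X) :
    regionMass p Sᶜ = 1 - regionMass p S := by
  rw [regionMass_compl, regionMass_univ, hp]

/-- One direction of the `(ε, δ)`-differential-privacy inequality for the PAIR of output laws
`p = law M(D)`, `q = law M(D')` of two neighbouring databases: `P(M(D) ∈ S) ≤ e^ε P(M(D') ∈ S) + δ`
for every set `S` of outputs. [cite: KairouzOhViswanath2017, Def. 1.1] -/
def RegionwiseLE (ε δ : ℝ) (p q : X → ℝ) : Prop :=
  ∀ S : Finset X, regionMass p S ≤ exp ε * regionMass q S + δ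

/-- `(ε, δ)`-DP restricted to one neighbouring pair: Definition 1.1 quantifies over all ordered
neighbouring pairs, so for the unordered pair `{D, D'}` it gives BOTH one-sided inequalities.
[cite: KairouzOhViswanath2017, Def. 1.1] -/
def IsDPPair (ε δ : ℝ) (p q : X → ℝ) : Prop := RegionwiseLE ε δ p q ∧ RegionwiseLE ε δ q p

/-! ## Theorem 2.1: the false-alarm / missed-detection conditions

Hypothesis test `H₀ : Y ~ p₀` (output of `M(D₀)`) against `H₁ : Y ~ p₁` (output of `M(D₁)`) with
rejection region `S`: `P_FA(S) = p₀(S)` (type I) and `P_MD(S) = p₁(Sᶜ) = 1 − p₁(S)` (type II). -/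

/-- False-alarm probability of the rejection region `S` under the null law `p₀`.
[cite: KairouzOhViswanath2017, §2 (definition of P_FA)] -/
def pFA (p₀ : X → ℝ) (S : Finset X) : ℝ := regionMass p₀ S

/-- Missed-detection probability of the rejection region `S` under the alternative law `p₁`:
the mass of the complement of `S`. [cite: KairouzOhViswanath2017, §2 (definition of P_MD)] -/
def pMD (p₁ : X → ℝ) (S : Finset X) : ℝ := regionMass p₁ Sᶜ

/-- **Theorem 2.1, first condition (DP ⇒):** `P_FA(S) + e^ε · P_MD(S) ≥ 1 − δ` for every rejection
region, from the inequality `p₀(Sᶜ) ≤ e^ε p₁(Sᶜ) + δ` (the `D₀ → D₁` direction applied to the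
complement) and `Σ p₀ = 1`. [cite: KairouzOhViswanath2017, §2 Thm 2.1 eq. (1)] -/
theorem pfa_add_exp_mul_pmd_ge {ε δ : ℝ} {p₀ p₁ : X → ℝ} (h : IsDPPair ε δ p₀ p₁)
    (hp₀ : ∑ x, p₀ x = 1) (S : Finset X) :
    1 - δ ≤ pFA p₀ S + exp ε * pMD p₁ S := by
  have h1 := h.1 Sᶜ
  rw [regionMass_compl_of_sum_eq_one hp₀] at h1
  unfold pFA pMD
  linarith

/-- **Theorem 2.1, second condition (DP ⇒):** `e^ε · P_FA(S) + P_MD(S) ≥ 1 − δ`, from the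
inequality `p₁(S) ≤ e^ε p₀(S) + δ` (the `D₁ → D₀` direction) and `Σ p₁ = 1`.
[cite: KairouzOhViswanath2017, §2 Thm 2.1 eq. (1)] -/
theorem exp_mul_pfa_add_pmd_ge {ε δ : ℝ} {p₀ p₁ : X → ℝ} (h : IsDPPair ε δ p₀ p₁)
    (hp₁ : ∑ x, p₁ x = 1) (S : Finset X) :
    1 - δ ≤ exp ε * pFA p₀ S + pMD p₁ S := by
  have h2 := h.2 S
  unfold pFA pMD
  rw [regionMass_compl_of_sum_eq_one hp₁]
  linarith

/-- **Theorem 2.1 for one neighbouring pair, both directions:** for laws `p₀`, `p₁` of total mass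
one, the pair satisfies the `(ε, δ)`-DP inequalities (both ways) if and only if every rejection
region satisfies the two false-alarm / missed-detection conditions.  (The printed theorem
quantifies additionally over all neighbouring pairs of the mechanism; that quantifier commutes
with this equivalence.) [cite: KairouzOhViswanath2017, §2 Thm 2.1] -/
theorem isDPPair_iff_regionConditions {ε δ : ℝ} {p₀ p₁ : X → ℝ} (hp₀ : ∑ x, p₀ x = 1)
    (hp₁ : ∑ x, p₁ x = 1) :
    IsDPPair ε δ p₀ p₁ ↔
      ∀ S : Finset X, 1 - δ ≤ pFA p₀ S + exp ε * pMD p₁ S ∧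
        1 - δ ≤ exp ε * pFA p₀ S + pMD p₁ S := by
  constructor
  · intro h S
    exact ⟨pfa_add_exp_mul_pmd_ge h hp₀ S, exp_mul_pfa_add_pmd_ge h hp₁ S⟩
  · intro h
    refine ⟨fun S => ?_, fun S => ?_⟩
    · -- `p₀(S) ≤ e^ε p₁(S) + δ` from the first condition at the region `Sᶜ`
      have hc := (h Sᶜ).1
      unfold pFA pMD at hc
      rw [compl_compl, regionMass_compl_of_sum_eq_one hp₀] at hc
      linarith
    · -- `p₁(S) ≤ e^ε p₀(S) + δ` from the second condition at the region `S`
      have hc := (h S).2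
      unfold pFA pMD at hc
      rw [regionMass_compl_of_sum_eq_one hp₁] at hc
      linarith

/-! ## Membership-inference consequences

A membership test answers ‘member’ (`H₁`) exactly on the region `S`: its true-positive rate is
`p₁(S)` and its false-positive rate is `p₀(S)`. -/

/-- **Membership advantage bound.** For an `(ε, δ)`-DP pair of output laws of total mass one and
any decision region `S`, `TPR − FPR = p₁(S) − p₀(S) ≤ (e^ε − 1 + 2δ)/(e^ε + 1)`: add the two
inequalities `p₁(S) ≤ e^ε p₀(S) + δ` and `1 − p₀(S) ≤ e^ε (1 − p₁(S)) + δ`.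
This is the printed proof of the cited theorem (there for the neighbouring-pair experiment
`ExpSTR` of an `(ε, δ)`-DP training algorithm; here for the two output laws themselves).
[cite: HumphriesEtAl2020MembershipInferenceDependencies, Thm III.1 eq. (2)] -/
theorem tpr_sub_fpr_le {ε δ : ℝ} {p₀ p₁ : X → ℝ} (h : IsDPPair ε δ p₀ p₁) (hp₀ : ∑ x, p₀ x = 1)
    (hp₁ : ∑ x, p₁ x = 1) (S : Finset X) :
    regionMass p₁ S - regionMass p₀ S ≤ (exp ε - 1 + 2 * δ) / (exp ε + 1) := by
  have hE : 0 < exp ε := exp_pos ε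
  have h2 := h.2 S
  have h1 := h.1 Sᶜ
  rw [regionMass_compl_of_sum_eq_one hp₀, regionMass_compl_of_sum_eq_one hp₁] at h1
  rw [le_div_iff₀ (by linarith)]
  nlinarith

/-- **Balanced-accuracy (‘attack success’) bound.** For an `(ε, δ)`-DP pair of output laws of total
mass one, every membership test has `(TPR + TNR)/2 = (p₁(S) + (1 − p₀(S)))/2 ≤ (e^ε + δ)/(e^ε + 1)`
— e.g. `≈ 0.622` at `(ε, δ) = (0.5, 0)` and `≈ 0.731` at `(1, 10⁻⁵)`.  This is the cited advantage
bound rewritten through the identity `(TPR + TNR)/2 = (1 + (TPR − FPR))/2`.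
[cite: HumphriesEtAl2020MembershipInferenceDependencies, Thm III.1 eq. (2) (balanced accuracy = (1 + Adv)/2)] -/
theorem balancedAccuracy_le {ε δ : ℝ} {p₀ p₁ : X → ℝ} (h : IsDPPair ε δ p₀ p₁)
    (hp₀ : ∑ x, p₀ x = 1) (hp₁ : ∑ x, p₁ x = 1) (S : Finset X) :
    (regionMass p₁ S + (1 - regionMass p₀ S)) / 2 ≤ (exp ε + δ) / (exp ε + 1) := by
  have hE : 0 < exp ε := exp_pos ε
  have hadv := tpr_sub_fpr_le h hp₀ hp₁ S
  rw [div_le_div_iff₀ (by norm_num) (by linarith)]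
  rw [le_div_iff₀ (by linarith)] at hadv
  nlinarith

/-- **Pure DP (`δ = 0`): membership advantage `≤ e^ε − 1`**, the form printed as
[cite: YeomEtAl2018, §3.1 Thm 1] (there for an `ε`-differentially-private learning algorithm in the
membership experiment of its Definition 4, advantage = TPR − FPR by its eq. (2)); here derived for
two output laws from the sharper `(e^ε − 1)/(e^ε + 1)` of `tpr_sub_fpr_le`. -/
theorem tpr_sub_fpr_le_exp_sub_one {ε : ℝ} {p₀ p₁ : X → ℝ} (h : IsDPPair ε 0 p₀ p₁)
    (hp₀ : ∑ x, p₀ x = 1) (hp₁ : ∑ x, p₁ x = 1) (hε : 0 ≤ ε) (S : Finset X) :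
    regionMass p₁ S - regionMass p₀ S ≤ exp ε - 1 := by
  have hE : 1 ≤ exp ε := one_le_exp hε
  have hadv := tpr_sub_fpr_le h hp₀ hp₁ S
  rw [mul_zero, add_zero] at hadv
  have hfrac : (exp ε - 1) / (exp ε + 1) ≤ exp ε - 1 := by
    rw [div_le_iff₀ (by linarith)]
    nlinarith
  linarith

/-- Sanity check of the constant: with no privacy loss (`ε = 0`, `δ = 0`) the balanced-accuracy
bound is `1/2`, i.e. no test beats a coin. [folklore] -/
example : (exp 0 + 0) / (exp 0 + 1) = (1 : ℝ) / 2 := by norm_num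

end Literature.Probability.HypothesisTesting

end
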